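import Summits.QuantumFields.YangMills.Theorems.F4SubCurvatureDoorFibreDichotomyAxisRungs
import Summits.QuantumFields.YangMills.Theorems.F4SubCurvatureDoorLowDegreeInvariants
import Summits.QuantumFields.YangMills.Theorems.F4SubCurvatureDoorFischerNormalForm
import Mathlib
import HarnessLib

/-!
# LINE g21-B «fibre dichotomy» (crux ⟨stmt-QuantumFields-23125⟩): rung R-B4b `InvariantHarmonicGap` BY NAME

Free-hands work of width seat `ym-line-sfw-p2-w3` (g37, cell `ym-idea-1`) on the OWNER's typed menu (ym-idea-3 g21, item (6); rungs file
`Cruxes/RationalToGeneral/Lines/fibre_dichotomy_rungs.lean` 7031e7b4ae186557).  The rung says: a harmonic homogeneous polynomial on `ℝ⁴` of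
degree `1 ≤ L ≤ 5` whose evaluations are invariant under every `D₄`-preserving isometry is `0`.  The algebra is ALREADY in the tree:
`F4SubCurvatureDoorLowDegreeInvariants.eq_zero_of_harmonic_F4_invariant_low_degree` (seat frs-p2 g14; invariance under the four sign flips,
the coordinate permutations and the Hadamard reflection `x ↦ x − ½(Σₖxₖ)𝟙`, all at the level of evaluations).  This file only shows that
these three kinds of maps ARE `D₄`-isometries — sign flips and permutations from `…FibreDichotomyAxisRungs` (`signIso`, `permIso`), and the
Hadamard REFLECTION `hadRefl` built here (involutive, norm-preserving, `z ↦ z − (Σz/2)𝟙` keeps `Σ` even) — and assembles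
`invariantHarmonicGap_holds : InvariantHarmonicGap` (Prop restated character-for-character).

HONEST LABEL: a rung (provable target) of an OPEN line; nothing of B4/B5/⟨23125⟩/⟨23035⟩/R2d is proved; the Yang–Mills mass gap is NOT
proved by this file.
-/

set_option autoImplicit false

noncomputable section

namespace Summit.QuantumFields.YangMills.Theorems.F4SubCurvatureDoorFibreDichotomyAxis

open scoped BigOperators
open MvPolynomial
open Literature.MathematicalPhysics.QuantumLattice (siteToE siteToE_apply)
open Summit.QuantumFields.YangMills.Theorems.F4SubCurvatureDoorLaplaceFourierRegistered (E4)
open Summit.QuantumFields.YangMills.Theorems.F4SubCurvatureDoorFischerNormalForm (IsHarmonicPoly)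
open Summit.QuantumFields.YangMills.Theorems.F4SubCurvatureDoorLowDegreeInvariants (eq_zero_of_harmonic_F4_invariant_low_degree)

/-! ## The registered text (verbatim from the rungs file) -/

/-- R-B4b «INVARIANT HARMONIC GAP» (S–M): no non-zero `W(F₄)`-invariant harmonic polynomial on `ℝ⁴` in degrees `1 … 5`.
[Humphreys1990 Table 3.1: degrees of F₄ are 2, 6, 8, 12] -/
def InvariantHarmonicGap : Prop :=
  ∀ (L : ℕ) (P : MvPolynomial (Fin 4) ℝ), 1 ≤ L → L ≤ 5 → P.IsHomogeneous L → IsHarmonicPoly P →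
    (∀ R : E4 ≃ₗᵢ[ℝ] E4, IsD4Isometry R →
        ∀ x : E4, MvPolynomial.eval (fun i => (R x) i) P = MvPolynomial.eval (fun i => x i) P) →
    P = 0

/-! ## The Hadamard reflection `x ↦ x − ½(Σₖ xₖ)𝟙` is a `D₄`-isometry -/

/-- The Hadamard reflection as a linear map. -/
def hadReflLin : E4 →ₗ[ℝ] E4 where
  toFun x := mk4 (x 0 - (x 0 + x 1 + x 2 + x 3) / 2) (x 1 - (x 0 + x 1 + x 2 + x 3) / 2)
    (x 2 - (x 0 + x 1 + x 2 + x 3) / 2) (x 3 - (x 0 + x 1 + x 2 + x 3) / 2)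
  map_add' x y := by
    ext i; fin_cases i <;> simp <;> ring
  map_smul' a x := by
    ext i; fin_cases i <;> simp <;> ring

/-- The Hadamard reflection is an involution. -/
theorem hadReflLin_involutive : Function.Involutive hadReflLin := by
  intro x
  ext i
  fin_cases i <;> simp [hadReflLin] <;> ring

/-- The Hadamard reflection preserves norms. -/
theorem norm_hadReflLin (x : E4) : ‖hadReflLin x‖ = ‖x‖ := by
  have h : ‖hadReflLin x‖ ^ 2 = ‖x‖ ^ 2 := by
    rw [EuclideanSpace.real_norm_sq_eq, EuclideanSpace.real_norm_sq_eq, Fin.sum_univ_four, Fin.sum_univ_four]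
    simp [hadReflLin]
    ring
  nlinarith [norm_nonneg (hadReflLin x), norm_nonneg x]

/-- The HADAMARD REFLECTION `x ↦ x − ½(Σₖ xₖ)(1,1,1,1)` (reflection in the hyperplane orthogonal to `(1,1,1,1)`; the `F₄` generator that
is not in `W(B₄)`). -/
def hadRefl : E4 ≃ₗᵢ[ℝ] E4 :=
  LinearIsometryEquiv.mk (LinearEquiv.ofInvolutive hadReflLin hadReflLin_involutive) norm_hadReflLin

/-- Coordinates of the Hadamard reflection. -/
theorem hadRefl_apply (x : E4) (j : Fin 4) : (hadRefl x) j = x j - (1 / 2) * ∑ k : Fin 4, x k := by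
  rw [Fin.sum_univ_four]
  fin_cases j <;> simp [hadRefl, hadReflLin] <;> ring

/-- The Hadamard reflection preserves the checkerboard lattice `D₄`. -/
theorem isD4Isometry_hadRefl : IsD4Isometry hadRefl := by
  intro z hz
  obtain ⟨m, hm⟩ := hz
  have hs : z 0 + z 1 + z 2 + z 3 = m + m := by rw [← hm, Fin.sum_univ_four]
  refine ⟨fun j => z j - m, ⟨-m, by rw [Fin.sum_univ_four]; omega⟩, ?_⟩
  ext j
  rw [hadRefl_apply, siteToE_apply, Fin.sum_univ_four, siteToE_apply, siteToE_apply, siteToE_apply, siteToE_apply,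
    siteToE_apply]
  have hm' : (m : ℝ) = ((z 0 : ℝ) + z 1 + z 2 + z 3) / 2 := by
    have := congrArg (fun n : ℤ => (n : ℝ)) hs; push_cast at this; linarith
  push_cast
  rw [hm']
  ring

/-! ## R-B4b -/

/-- **R-B4b `InvariantHarmonicGap`** BY NAME: `D₄`-invariance supplies the sign flips, permutations and the Hadamard reflection of
`eq_zero_of_harmonic_F4_invariant_low_degree`. -/
theorem invariantHarmonicGap_holds : InvariantHarmonicGap := by
  intro L P hL1 hL5 hhom hharm hinv
  -- evaluations at `Fin 4 → ℝ` points through `E4`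
  have key : ∀ (R : E4 ≃ₗᵢ[ℝ] E4), IsD4Isometry R → ∀ x : Fin 4 → ℝ,
      MvPolynomial.eval (fun i => (R (WithLp.toLp 2 x)) i) P = MvPolynomial.eval x P := by
    intro R hR x
    have h := hinv R hR (WithLp.toLp 2 x)
    simpa using h
  refine eq_zero_of_harmonic_F4_invariant_low_degree hL1 (by omega) hhom hharm ?_ ?_ ?_
  · -- sign flips
    intro i x
    have h := key (signIso fun j => decide (j ≠ i)) (isD4Isometry_signIso _) x
    have e : (fun j => (if j = i then (-1 : ℝ) else 1) * x j) =
        fun j => ((signIso fun j => decide (j ≠ i)) (WithLp.toLp 2 x)) j := by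
      funext j
      rw [signIso_apply]
      by_cases hji : j = i
      · simp [hji]
      · simp [hji]
    rw [e]; exact h
  · -- permutations
    intro τ x
    have h := key (permIso τ.symm) (isD4Isometry_permIso _) x
    have e : (x ∘ τ) = fun j => ((permIso τ.symm) (WithLp.toLp 2 x)) j := by
      funext j
      rw [permIso_apply]
      simp
    rw [e]; exact h
  · -- the Hadamard reflection
    intro x
    have h := key hadRefl isD4Isometry_hadRefl x
    have e : (fun j => x j - 1 / 2 * ∑ k, x k) = fun j => (hadRefl (WithLp.toLp 2 x)) j := by
      funext j
      rw [hadRefl_apply]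
    rw [e]; exact h

end Summit.QuantumFields.YangMills.Theorems.F4SubCurvatureDoorFibreDichotomyAxis

end
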